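import Mathlib
import Literature.NumberTheory.LFunctions.WeilGroundState
import Literature.NumberTheory.LFunctions.WeilGroundStateRealZerosProofs
import Summits.RiemannHypothesis.RiemannHypothesis.Theorems.WeilGroundStateGroundStateSimpleEvenStubIntertwineContinuity
import Summits.RiemannHypothesis.RiemannHypothesis.Theorems.WeilGroundStateGroundStateSimpleEvenStubIntertwineKernel
import Summits.RiemannHypothesis.RiemannHypothesis.Theorems.WeilGroundStateGroundStateSimpleEvenStubIntertwineApprox
import Summits.RiemannHypothesis.RiemannHypothesis.Theorems.WeilGroundStateGroundStateSimpleEvenStubIntertwineOddPart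
import HarnessLib

/-!
# Crux `GroundStateSimpleEven` (stmt-RiemannHypothesis-1526), line `parity-multiplicity-commutator`
# (v2), stub (OP) `stub_oddPrimitive_approximants`: odd-primitive approximants

Support file (`--supports stmt-RiemannHypothesis-1526`) proving the registered stub
`stub_oddPrimitive_approximants` of the v2 skeleton verbatim.  Normalisation of
`Literature/NumberTheory/LFunctions/WeilExplicit.lean`: `W = weilFunctional`, `g̃ = weilReflect g`,
`⋆ = weilConv`, `ε = ε(a) = weilGroundEnergy a`; ground states `IsWeilGroundState a u` as in
`WeilGroundState.lean`.

## Statement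

Let `u₁, u₂` be EVEN ground states at window `a > 0`, `c₁ c₂ : ℂ` with `∫ G = 0` for
`G = c₂u₁ − c₁u₂`, and let `U(t) = ∫_{-a}^t G` be the window primitive (odd, continuous, zero off
the window).  Then there are ODD window test functions `oₙ → U` in `L²` with `∫|oₙ'|²` bounded,
along which `W(oₙ ⋆ χ̃) → ε ∫ U conj χ` for every ODD window test function `χ`.

## Proof (the INTERTWINE machinery of the sibling files with function and primitive swapped)

1. Window test functions `Pₙ → G` in `L²` (minimising sequences of `u₁, u₂`), corrected to mean
   zero: `kₙ = Pₙ − (∫Pₙ)β`, `∫ β = 1` (`exists_meanZero_approximants`).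
2. Window primitives `hₙ = ∫_{-a}^t kₙ` (`exists_windowPrimitive`); `hₙ → U` in `L²`
   (`integral_norm_sq_primitive_le`).
3. Odd parts `oₙ = ½(hₙ − hₙ(-·)) → U` (`U` is odd; odd parts are `L²`-contractions), and
   `oₙ' = ½(kₙ + kₙ(-·))` has `∫|oₙ'|² ≤ ∫|kₙ|² → ∫|G|²`, hence bounded.
4. For an odd window test `χ` (so `∫ χ = 0`) with window primitive `ψ`:
   `W(hₙ ⋆ χ̃) = −W(kₙ ⋆ ψ̃)` (kernel identity `weilFunctional_weilConv_deriv_left`)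
   `→ −ε ∫ G conj ψ` (weak Euler–Lagrange equation along every approximating sequence,
   `tendsto_weilFunctional_weilConv_of_tendsto_comb`) `= ε ∫ U conj χ` (integration by parts in the
   limit), and the limit transfers from `hₙ` to `oₙ`
   (`tendsto_weilFunctional_weilConv_of_tendsto_sub`).

Mathlib + proved tree files only; no definitions, no named facts.
-/

noncomputable section

open Set MeasureTheory Filter Complex
open scoped Real Topology ComplexConjugate

namespace Summit.RiemannHypothesis.RiemannHypothesis.Theorems.GroundStateSimpleEven

open Literature.NumberTheory.LFunctions

-- `linter.dupNamespace` off: the mandated namespace `Summit.RiemannHypothesis.RiemannHypothesis.…`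
-- (single-problem summit) repeats a component.
set_option linter.dupNamespace false

/-! ## §1. Mean-zero correction of window approximants -/

section MeanZero

variable {a : ℝ} {G : ℝ → ℂ} {P : ℕ → ℝ → ℂ}

/-- **Mean-zero correction.** If window test functions `Pₙ` converge in `L²` to `G ∈ L²`, `G`
vanishing a.e. off `[-a, a]` with `∫ G = 0`, then the window test functions
`kₙ = Pₙ − (∫ Pₙ) β` (`β` a window bump with `∫ β = 1`) have `∫ kₙ = 0` and still `kₙ → G` in `L²`
(`|∫ Pₙ| = |∫ (Pₙ − G)| ≤ √(2a) ‖Pₙ − G‖₂ → 0`). [folklore] -/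
theorem exists_meanZero_approximants (ha : 0 < a) (hGm : MemLp G 2)
    (hGz : ∀ᵐ t : ℝ, t ∉ Icc (-a) a → G t = 0) (hG0 : ∫ t, G t = 0)
    (hP : ∀ n, IsWeilTest (P n) ∧ tsupport (P n) ⊆ Icc (-a) a)
    (hPL : Tendsto (fun n ↦ ∫ t, ‖P n t - G t‖ ^ 2) atTop (𝓝 0)) :
    ∃ k : ℕ → ℝ → ℂ, (∀ n, IsWeilTest (k n) ∧ tsupport (k n) ⊆ Icc (-a) a) ∧
      (∀ n, ∫ t, k n t = 0) ∧ Tendsto (fun n ↦ ∫ t, ‖k n t - G t‖ ^ 2) atTop (𝓝 0) := by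
  have hPm : ∀ n, MemLp (P n) 2 := fun n ↦ ConnesVanSuijlekom.isWeilTest_memLp (hP n).1
  have hPi : ∀ n, Integrable (P n) := fun n ↦
    (hP n).1.1.continuous.integrable_of_hasCompactSupport (hP n).1.2
  have hGi : Integrable G := integrable_of_memLp_two_window hGm hGz
  have hz : ∀ n, ∀ᵐ t : ℝ, t ∉ Icc (-a) a → P n t - G t = 0 := fun n ↦
    hGz.mono fun t ht hts ↦ by rw [ht hts, eq_zero_of_tsupport_subset (hP n).2 hts, sub_zero]
  -- the means `mₙ = ∫ Pₙ → ∫ G = 0`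
  set m : ℕ → ℂ := fun n ↦ ∫ t, P n t with hm
  have hm0 : Tendsto m atTop (𝓝 0) := by
    refine squeeze_zero_norm (a := fun n ↦ √(2 * a) * √(∫ t, ‖P n t - G t‖ ^ 2))
      (fun n ↦ ?_) ?_
    · have e : m n = ∫ t, (P n t - G t) := by
        rw [integral_sub (hPi n) hGi, hG0, sub_zero]
      rw [e]
      exact norm_integral_le_sqrt_window ha.le ((hPm n).sub hGm) (hz n)
    · simpa using (hPL.sqrt).const_mul (√(2 * a))
  -- the correction `kₙ = Pₙ − mₙ β`
  obtain ⟨β, hβ, hβs, hβ1⟩ := exists_window_bump ha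
  have hβm : MemLp β 2 := ConnesVanSuijlekom.isWeilTest_memLp hβ
  have hβi : Integrable β := hβ.1.continuous.integrable_of_hasCompactSupport hβ.2
  refine ⟨fun n t ↦ P n t - m n * β t, fun n ↦ ⟨(hP n).1.sub (hβ.const_mul (m n)),
    tsupport_sub_subset_Icc (hP n).2 (tsupport_mul_subset_right.trans hβs)⟩, fun n ↦ ?_, ?_⟩
  · show ∫ t, (P n t - m n * β t) = 0
    rw [integral_sub (hPi n) (hβi.const_mul _), integral_const_mul, hβ1, mul_one, sub_self]
  · show Tendsto (fun n ↦ ∫ t, ‖(P n t - m n * β t) - G t‖ ^ 2) atTop (𝓝 0)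
    have hb : ∀ n, √(∫ t, ‖(P n t - m n * β t) - G t‖ ^ 2) ≤
        √(∫ t, ‖P n t - G t‖ ^ 2) + ‖m n‖ * √(∫ t, ‖β t‖ ^ 2) := by
      intro n
      have h1 := sqrt_integral_norm_sq_sub_le ((hPm n).sub hGm) (hβm.const_mul (m n))
      have e2 : ∫ t, ‖m n * β t‖ ^ 2 = ‖m n‖ ^ 2 * ∫ t, ‖β t‖ ^ 2 := by
        simp only [norm_mul, mul_pow]
        rw [integral_const_mul]
      simp only [Pi.sub_apply] at h1
      rw [e2, Real.sqrt_mul (sq_nonneg _), Real.sqrt_sq (norm_nonneg _)] at h1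
      have e1 : ∀ t, P n t - G t - m n * β t = (P n t - m n * β t) - G t := fun t ↦ by ring
      simp_rw [e1] at h1
      exact h1
    have hlim : Tendsto (fun n ↦ √(∫ t, ‖P n t - G t‖ ^ 2) + ‖m n‖ * √(∫ t, ‖β t‖ ^ 2))
        atTop (𝓝 0) := by
      have h1 := hPL.sqrt
      have h2 := (hm0.norm).mul_const (√(∫ t, ‖β t‖ ^ 2))
      rw [Real.sqrt_zero] at h1
      rw [norm_zero, zero_mul] at h2
      simpa using h1.add h2
    have hsq := (squeeze_zero (fun n ↦ Real.sqrt_nonneg _) hb hlim).pow 2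
    rw [zero_pow two_ne_zero] at hsq
    exact hsq.congr fun n ↦ Real.sq_sqrt (integral_nonneg fun _ ↦ by positivity)

end MeanZero

/-! ## §2. The window primitive of an even mean-zero function; odd parts of primitives -/

section OddPrimitive

variable {a : ℝ} {G : ℝ → ℂ}

/-- An odd function has integral zero (`∫ χ = ∫ χ(-·) = −∫ χ`; no integrability needed).
[folklore] -/
private theorem integral_eq_zero_of_odd_aux {χ : ℝ → ℂ} (hodd : ∀ t, χ (-t) = -χ t) :
    ∫ t, χ t = 0 := by
  have h1 : ∫ t, χ (-t) = ∫ t, χ t := integral_neg_eq_self χ volume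
  have h2 : ∫ t, χ (-t) = -∫ t, χ t := by
    simp_rw [hodd]
    exact integral_neg χ
  linear_combination (h1.symm.trans h2) / 2

/-- **The window primitive of an even function is odd**: for `G` integrable and even with
`∫_{-a}^{a} G = 0`, `∫_{-a}^{-t} G = −∫_{-a}^{t} G`
(`∫_{-a}^{-t} G = ∫_t^a G(-·) = ∫_t^a G = ∫_{-a}^a G − ∫_{-a}^t G`). [folklore] -/
theorem primitive_neg_of_even (hGi : Integrable G) (hev : ∀ t, G (-t) = G t)
    (h0 : ∫ s in (-a)..a, G s = 0) (t : ℝ) :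
    ∫ s in (-a)..(-t), G s = -∫ s in (-a)..t, G s := by
  have h1 : ∫ s in (-a)..(-t), G s = ∫ s in t..a, G (-s) :=
    (intervalIntegral.integral_comp_neg G).symm
  have h2 : ∫ s in t..a, G (-s) = ∫ s in t..a, G s := by simp_rw [hev]
  have h3 : (∫ s in (-a)..t, G s) + ∫ s in t..a, G s = ∫ s in (-a)..a, G s :=
    intervalIntegral.integral_add_adjacent_intervals hGi.intervalIntegrable hGi.intervalIntegrable
  rw [h1, h2]
  linear_combination h3 + h0

/-- The window primitive of an integrable `G` vanishing a.e. off `[-a, a]` with `∫ G = 0` vanishes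
off the window. [folklore] -/
theorem primitive_eq_zero_of_notMem_window (ha : 0 ≤ a) (hGi : Integrable G)
    (hGz : ∀ᵐ t : ℝ, t ∉ Icc (-a) a → G t = 0) (hG0 : ∫ t, G t = 0) {t : ℝ}
    (ht : t ∉ Icc (-a) a) : ∫ s in (-a)..t, G s = 0 := by
  rw [mem_Icc, not_and_or, not_le, not_le] at ht
  rcases ht with h | h
  · exact primitive_eq_zero_of_le hGz h.le
  · rw [primitive_eq_integral_of_le ha hGi hGz h.le, hG0]

/-- The window primitive of an integrable `G` vanishing a.e. off `[-a, a]` with `∫ G = 0` is a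
continuous function supported in the window, hence square integrable. [folklore] -/
theorem memLp_two_primitive_window (ha : 0 ≤ a) (hGi : Integrable G)
    (hGz : ∀ᵐ t : ℝ, t ∉ Icc (-a) a → G t = 0) (hG0 : ∫ t, G t = 0) :
    MemLp (fun t ↦ ∫ s in (-a)..t, G s) 2 :=
  (intervalIntegral.continuous_primitive (fun _ _ ↦ hGi.intervalIntegrable) (-a))
    |>.memLp_of_hasCompactSupport (HasCompactSupport.intro isCompact_Icc fun _ ht ↦
      primitive_eq_zero_of_notMem_window ha hGi hGz hG0 ht)

/-- The derivative of the odd part of a test function: `(½(h − h(-·)))' = ½(h' + h'(-·))`.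
[folklore] -/
theorem deriv_oddPart_apply {h : ℝ → ℂ} (hh : IsWeilTest h) (t : ℝ) :
    deriv (fun s ↦ (h s - h (-s)) / 2) t = (deriv h t + deriv h (-t)) / 2 := by
  have h1 : DifferentiableAt ℝ h t := hh.1.differentiable (by simp) t
  have h2 : DifferentiableAt ℝ (fun s ↦ h (-s)) t := hh.comp_neg.1.differentiable (by simp) t
  rw [deriv_div_const, deriv_fun_sub h1 h2, deriv_comp_neg, sub_neg_eq_add]

/-- **The odd part of a primitive has a small derivative**: if `h` is a test function with
`h' = k`, then `∫ |(½(h − h(-·)))'|² = ∫ |½(k + k(-·))|² ≤ ∫ |k|²` (parity splitting of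
`∫|k|²`, `ConnesVanSuijlekom.integral_norm_sq_eq_evenPart_add_oddPart`). [folklore] -/
theorem integral_norm_sq_deriv_oddPart_le {h k : ℝ → ℂ} (hh : IsWeilTest h) (hd : deriv h = k) :
    ∫ t, ‖deriv (fun s ↦ (h s - h (-s)) / 2) t‖ ^ 2 ≤ ∫ t, ‖k t‖ ^ 2 := by
  have hk : IsWeilTest k := hd ▸ hh.deriv
  have e : ∀ t, deriv (fun s ↦ (h s - h (-s)) / 2) t = (k t + k (-t)) / 2 := fun t ↦ by
    rw [deriv_oddPart_apply hh, hd]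
  simp_rw [e]
  rw [ConnesVanSuijlekom.integral_norm_sq_eq_evenPart_add_oddPart hk]
  exact le_add_of_nonneg_right (integral_nonneg fun t ↦ by positivity)

end OddPrimitive

/-! ## §3. Odd-primitive approximants -/

section Core

variable {a : ℝ} {G u₁ u₂ : ℝ → ℂ}

/-- **Odd-primitive approximants, abstract form.** Let `a > 0`, `G ∈ L²` even, vanishing a.e. off
`[-a, a]`, with `∫ G = 0`, approximable in `L²` by window test functions, and satisfying the weak
Euler–Lagrange equation along EVERY approximating sequence of window test functions `kₙ → G`:
`W(kₙ ⋆ ψ̃) → ε(a) ∫ G conj ψ` for all window tests `ψ`.  Then the window primitive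
`U = ∫_{-a}^t G` is the `L²`-limit of ODD window test functions `oₙ` with `∫|oₙ'|²` bounded and
`W(oₙ ⋆ χ̃) → ε(a) ∫ U conj χ` for every odd window test `χ` (module docstring, steps 1–4).
[folklore] -/
theorem exists_oddPrimitive_approximants_of_eulerLagrange (ha : 0 < a) (hGm : MemLp G 2)
    (hGz : ∀ᵐ t : ℝ, t ∉ Icc (-a) a → G t = 0) (hG0 : ∫ t, G t = 0)
    (hGev : ∀ t, G (-t) = G t)
    (hP : ∃ P : ℕ → ℝ → ℂ, (∀ n, IsWeilTest (P n) ∧ tsupport (P n) ⊆ Icc (-a) a) ∧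
      Tendsto (fun n ↦ ∫ t, ‖P n t - G t‖ ^ 2) atTop (𝓝 0))
    (hEL : ∀ k : ℕ → ℝ → ℂ, (∀ n, IsWeilTest (k n) ∧ tsupport (k n) ⊆ Icc (-a) a) →
      Tendsto (fun n ↦ ∫ t, ‖k n t - G t‖ ^ 2) atTop (𝓝 0) →
      ∀ ψ : ℝ → ℂ, IsWeilTest ψ → tsupport ψ ⊆ Icc (-a) a →
        Tendsto (fun n ↦ weilFunctional (weilConv (k n) (weilReflect ψ))) atTop
          (𝓝 ((weilGroundEnergy a : ℂ) * ∫ t, G t * conj (ψ t)))) :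
    ∃ o : ℕ → ℝ → ℂ, (∀ n, IsWeilTest (o n) ∧ tsupport (o n) ⊆ Icc (-a) a ∧
        ∀ t, o n (-t) = -o n t) ∧
      Tendsto (fun n ↦ ∫ t, ‖o n t - ∫ s in (-a)..t, G s‖ ^ 2) atTop (𝓝 0) ∧
      (∃ M : ℝ, ∀ n, ∫ t, ‖deriv (o n) t‖ ^ 2 ≤ M) ∧
      ∀ χ : ℝ → ℂ, IsWeilTest χ → tsupport χ ⊆ Icc (-a) a → (∀ t, χ (-t) = -χ t) →
        Tendsto (fun n ↦ weilFunctional (weilConv (o n) (weilReflect χ))) atTop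
          (𝓝 ((weilGroundEnergy a : ℂ) * ∫ t, (∫ s in (-a)..t, G s) * conj (χ t))) := by
  have hGi : Integrable G := integrable_of_memLp_two_window hGm hGz
  -- the window primitive `U` of `G`: odd and square integrable
  set U : ℝ → ℂ := fun t ↦ ∫ s in (-a)..t, G s with hU
  have hUodd : ∀ t, U (-t) = -U t := fun t ↦
    primitive_neg_of_even hGi hGev (by rw [intervalIntegral_window_eq_integral ha.le hGz, hG0]) t
  have hUm : MemLp U 2 := memLp_two_primitive_window ha.le hGi hGz hG0
  -- (1) mean-zero window approximants `kₙ → G`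
  obtain ⟨P, hPt, hPL⟩ := hP
  obtain ⟨k, hkt, hk0, hkL⟩ := exists_meanZero_approximants ha hGm hGz hG0 hPt hPL
  have hkm : ∀ n, MemLp (k n) 2 := fun n ↦ ConnesVanSuijlekom.isWeilTest_memLp (hkt n).1
  have hki : ∀ n, Integrable (k n) := fun n ↦
    (hkt n).1.1.continuous.integrable_of_hasCompactSupport (hkt n).1.2
  have hkz : ∀ n, ∀ᵐ t : ℝ, t ∉ Icc (-a) a → k n t - G t = 0 := fun n ↦
    hGz.mono fun t ht hts ↦ by rw [ht hts, eq_zero_of_tsupport_subset (hkt n).2 hts, sub_zero]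
  -- (2) window primitives `hₙ` of `kₙ`; `hₙ → U` in `L²`
  have hex : ∀ n, ∃ v : ℝ → ℂ, IsWeilTest v ∧ tsupport v ⊆ Icc (-a) a ∧ deriv v = k n ∧
      ∀ t, v t = ∫ τ in (-a)..t, k n τ :=
    fun n ↦ exists_windowPrimitive (hkt n).1 (hkt n).2 (hk0 n)
  choose h hht hhs hhd hhi using hex
  have hhm : ∀ n, MemLp (h n) 2 := fun n ↦ ConnesVanSuijlekom.isWeilTest_memLp (hht n)
  have hhL : Tendsto (fun n ↦ ∫ t, ‖h n t - U t‖ ^ 2) atTop (𝓝 0) := by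
    have heq : ∀ n, ∫ t, ‖h n t - U t‖ ^ 2 = ∫ t, ‖∫ s in (-a)..t, (k n s - G s)‖ ^ 2 := by
      intro n
      congr 1 with t
      rw [hhi n t, intervalIntegral.integral_sub (hki n).intervalIntegrable hGi.intervalIntegrable]
    simp_rw [heq]
    refine squeeze_zero (fun n ↦ integral_nonneg fun _ ↦ by positivity)
      (fun n ↦ integral_norm_sq_primitive_le ha ((hkm n).sub hGm) (hkz n) ?_) ?_
    · rw [integral_sub (hki n) hGi, hk0 n, hG0, sub_zero]
    · simpa using hkL.const_mul (4 * a ^ 2)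
  -- (3) odd parts `oₙ → U` (`U` is odd), with `∫|oₙ'|² ≤ ∫|kₙ|²` bounded
  set o : ℕ → ℝ → ℂ := fun n t ↦ (h n t - h n (-t)) / 2 with ho
  have hot : ∀ n, IsWeilTest (o n) ∧ tsupport (o n) ⊆ Icc (-a) a := fun n ↦
    ⟨isWeilTest_oddPart' (hht n), tsupport_oddPart_subset (hhs n)⟩
  have hom : ∀ n, MemLp (o n) 2 := fun n ↦ ConnesVanSuijlekom.isWeilTest_memLp (hot n).1
  have hoL : Tendsto (fun n ↦ ∫ t, ‖o n t - U t‖ ^ 2) atTop (𝓝 0) := by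
    refine (tendsto_integral_norm_sq_oddPart hUm hhm hhL).congr fun n ↦ ?_
    congr 1 with t
    have e : (h n t - h n (-t)) / 2 - (U t - U (-t)) / 2 = o n t - U t := by
      rw [hUodd t]
      simp only [ho]
      ring
    rw [e]
  obtain ⟨M, hM⟩ : ∃ M : ℝ, ∀ n, ∫ t, ‖k n t‖ ^ 2 ≤ M := by
    obtain ⟨M, hM⟩ := (ConnesVanSuijlekom.tendsto_integral_norm_sq hGm hkm hkL).bddAbove_range
    exact ⟨M, fun n ↦ hM ⟨n, rfl⟩⟩
  have hoD : ∀ n, ∫ t, ‖deriv (o n) t‖ ^ 2 ≤ M := fun n ↦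
    (integral_norm_sq_deriv_oddPart_le (hht n) (hhd n)).trans (hM n)
  refine ⟨o, fun n ↦ ⟨(hot n).1, (hot n).2, fun t ↦ ?_⟩, hoL, ⟨M, hoD⟩, fun χ hχ hχs hχo ↦ ?_⟩
  · simp only [ho, neg_neg]
    ring
  -- (4) the weak eigen-equation against an odd window test `χ = ψ'`
  obtain ⟨ψ, hψ, hψs, hψd, -⟩ := exists_windowPrimitive hχ hχs (integral_eq_zero_of_odd_aux hχo)
  have hχm : MemLp χ 2 := ConnesVanSuijlekom.isWeilTest_memLp hχ
  have hψm : MemLp ψ 2 := ConnesVanSuijlekom.isWeilTest_memLp hψ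
  -- integration by parts in the limit: `∫ G conj ψ = -∫ U conj χ`
  have hIBP : ∫ t, G t * conj (ψ t) = -∫ t, U t * conj (χ t) := by
    have h1 : Tendsto (fun n ↦ ∫ t, k n t * conj (ψ t)) atTop (𝓝 (∫ t, G t * conj (ψ t))) :=
      ConnesVanSuijlekom.tendsto_integral_mul_conj_left hψm hGm hkm hkL
    have h2 : Tendsto (fun n ↦ ∫ t, h n t * conj (χ t)) atTop (𝓝 (∫ t, U t * conj (χ t))) :=
      ConnesVanSuijlekom.tendsto_integral_mul_conj_left hχm hUm hhm hhL
    have h3 : ∀ n, ∫ t, k n t * conj (ψ t) = -∫ t, h n t * conj (χ t) := fun n ↦ by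
      have h4 := integral_deriv_mul_conj (hht n) hψ
      rwa [hhd n, hψd] at h4
    simp_rw [h3] at h1
    exact tendsto_nhds_unique h1 h2.neg
  -- `W(hₙ ⋆ χ̃) = -W(kₙ ⋆ ψ̃) → -ε ∫ G conj ψ = ε ∫ U conj χ`
  have hWh : Tendsto (fun n ↦ weilFunctional (weilConv (h n) (weilReflect χ))) atTop
      (𝓝 ((weilGroundEnergy a : ℂ) * ∫ t, U t * conj (χ t))) := by
    have e : ∀ n, weilFunctional (weilConv (h n) (weilReflect χ)) =
        -weilFunctional (weilConv (k n) (weilReflect ψ)) := fun n ↦ by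
      have h4 := weilFunctional_weilConv_deriv_left (hht n) hψ
      rw [hhd n, hψd] at h4
      rw [h4, neg_neg]
    simp_rw [e]
    have h5 := (hEL k hkt hkL ψ hψ hψs).neg
    rw [hIBP] at h5
    convert h5 using 2
    ring
  -- transfer from `hₙ` to `oₙ`
  exact tendsto_weilFunctional_weilConv_of_tendsto_sub ha hχ (fun n ↦ ⟨hht n, hhs n⟩) hot
    (tendsto_integral_norm_sq_sub_of_common_limit hUm hhm hom hhL hoL) hWh

/-- **Odd-primitive approximants for a mean-zero combination of two even ground states.** For even
ground states `u₁, u₂` at window `a` and `c₁ c₂ : ℂ` with `∫ (c₂u₁ − c₁u₂) = 0`, the window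
primitive `U = ∫_{-a}^t (c₂u₁ − c₁u₂)` is the `L²`-limit of odd window test functions `oₙ` with
`∫|oₙ'|²` bounded and `W(oₙ ⋆ χ̃) → ε(a) ∫ U conj χ` for every odd window test `χ`
(`exists_oddPrimitive_approximants_of_eulerLagrange` with the minimising sequences of `u₁, u₂` and
`tendsto_weilFunctional_weilConv_of_tendsto_comb`). [folklore] -/
theorem exists_oddPrimitive_approximants (hu₁ : IsWeilGroundState a u₁)
    (hu₂ : IsWeilGroundState a u₂) (hev₁ : ∀ t, u₁ (-t) = u₁ t) (hev₂ : ∀ t, u₂ (-t) = u₂ t)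
    (c₁ c₂ : ℂ) (hG0 : ∫ t, (c₂ * u₁ t - c₁ * u₂ t) = 0) :
    ∃ o : ℕ → ℝ → ℂ, (∀ n, IsWeilTest (o n) ∧ tsupport (o n) ⊆ Icc (-a) a ∧
        ∀ t, o n (-t) = -o n t) ∧
      Tendsto (fun n ↦ ∫ t, ‖o n t - ∫ s in (-a)..t, (c₂ * u₁ s - c₁ * u₂ s)‖ ^ 2)
        atTop (𝓝 0) ∧
      (∃ M : ℝ, ∀ n, ∫ t, ‖deriv (o n) t‖ ^ 2 ≤ M) ∧
      ∀ χ : ℝ → ℂ, IsWeilTest χ → tsupport χ ⊆ Icc (-a) a → (∀ t, χ (-t) = -χ t) →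
        Tendsto (fun n ↦ weilFunctional (weilConv (o n) (weilReflect χ))) atTop
          (𝓝 ((weilGroundEnergy a : ℂ) *
            ∫ t, (∫ s in (-a)..t, (c₂ * u₁ s - c₁ * u₂ s)) * conj (χ t))) := by
  have ha : 0 < a := hu₁.pos
  have hGm : MemLp (fun t ↦ c₂ * u₁ t - c₁ * u₂ t) 2 :=
    (hu₁.memLp.const_mul c₂).sub (hu₂.memLp.const_mul c₁)
  have hGz : ∀ᵐ t : ℝ, t ∉ Icc (-a) a → c₂ * u₁ t - c₁ * u₂ t = 0 := by
    filter_upwards [hu₁.ae_eq_zero_of_notMem, hu₂.ae_eq_zero_of_notMem] with t h1 h2 ht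
    rw [h1 ht, h2 ht, mul_zero, mul_zero, sub_zero]
  have hGev : ∀ t, c₂ * u₁ (-t) - c₁ * u₂ (-t) = c₂ * u₁ t - c₁ * u₂ t := fun t ↦ by
    rw [hev₁, hev₂]
  obtain ⟨g₁, hg₁, -, hL₁⟩ := hu₁.2
  obtain ⟨g₂, hg₂, -, hL₂⟩ := hu₂.2
  have hP : ∃ P : ℕ → ℝ → ℂ, (∀ n, IsWeilTest (P n) ∧ tsupport (P n) ⊆ Icc (-a) a) ∧
      Tendsto (fun n ↦ ∫ t, ‖P n t - (c₂ * u₁ t - c₁ * u₂ t)‖ ^ 2) atTop (𝓝 0) :=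
    ⟨fun n t ↦ c₂ * g₁ n t - c₁ * g₂ n t, fun n ↦
      ⟨IsWeilTest.sub ((hg₁ n).1.const_mul c₂) ((hg₂ n).1.const_mul c₁),
        tsupport_sub_subset_Icc (tsupport_mul_subset_right.trans (hg₁ n).2.1)
          (tsupport_mul_subset_right.trans (hg₂ n).2.1)⟩,
      tendsto_integral_norm_sq_comb hu₁.memLp hu₂.memLp
        (fun n ↦ ConnesVanSuijlekom.isWeilTest_memLp (hg₁ n).1)
        (fun n ↦ ConnesVanSuijlekom.isWeilTest_memLp (hg₂ n).1) c₁ c₂ hL₁ hL₂⟩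
  exact exists_oddPrimitive_approximants_of_eulerLagrange (G := fun t ↦ c₂ * u₁ t - c₁ * u₂ t)
    ha hGm hGz hG0 hGev hP fun k hk hkL ψ hψ hψs ↦
      tendsto_weilFunctional_weilConv_of_tendsto_comb hu₁ hu₂ c₁ c₂ hk hkL hψ hψs

end Core

end Summit.RiemannHypothesis.RiemannHypothesis.Theorems.GroundStateSimpleEven

namespace Summit.RiemannHypothesis.RiemannHypothesis.Theorems

open Literature.NumberTheory.LFunctions

set_option linter.dupNamespace false in
/-- **Registered stub (OP) of line `parity-multiplicity-commutator` (v2): odd-primitive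
approximants.** For EVEN ground states `u₁, u₂` at window `a > 0` and `c₁ c₂ : ℂ` with
`∫ (c₂u₁ − c₁u₂) = 0`, the window primitive `U(t) = ∫_{-a}^t (c₂u₁ − c₁u₂)` is the `L²`-limit of
ODD window test functions `oₙ` with `∫ |oₙ'|²` bounded, along which the weak eigen-equation holds in
the limit against every ODD window test `χ`: `W(oₙ ⋆ χ̃) → ε(a) ∫ U conj χ`
(`GroundStateSimpleEven.exists_oddPrimitive_approximants`: mean-zero correction, window primitives,
odd parts, kernel identity `W(P' ⋆ ψ̃) = −W(P ⋆ (ψ')̃)` and the weak Euler–Lagrange equation of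
`c₂u₁ − c₁u₂` along every approximating sequence, integration by parts in the limit). [folklore] -/
theorem stub_oddPrimitive_approximants :
    ∀ a : ℝ, 0 < a → ∀ u₁ u₂ : ℝ → ℂ, IsWeilGroundState a u₁ → IsWeilGroundState a u₂ →
      (∀ t, u₁ (-t) = u₁ t) → (∀ t, u₂ (-t) = u₂ t) → ∀ c₁ c₂ : ℂ,
      ∫ t, (c₂ * u₁ t - c₁ * u₂ t) = 0 →
      ∃ o : ℕ → ℝ → ℂ, (∀ n, IsWeilTest (o n) ∧ tsupport (o n) ⊆ Icc (-a) a ∧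
          ∀ t, o n (-t) = -o n t) ∧
        Tendsto (fun n => ∫ t, ‖o n t - ∫ s in (-a)..t, (c₂ * u₁ s - c₁ * u₂ s)‖ ^ 2)
          atTop (𝓝 0) ∧
        (∃ M : ℝ, ∀ n, ∫ t, ‖deriv (o n) t‖ ^ 2 ≤ M) ∧
        ∀ χ : ℝ → ℂ, IsWeilTest χ → tsupport χ ⊆ Icc (-a) a → (∀ t, χ (-t) = -χ t) →
          Tendsto (fun n => weilFunctional (weilConv (o n) (weilReflect χ))) atTop
            (𝓝 ((weilGroundEnergy a : ℂ) *
              ∫ t, (∫ s in (-a)..t, (c₂ * u₁ s - c₁ * u₂ s)) * starRingEnd ℂ (χ t))) :=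
  fun _ _ _ _ hu₁ hu₂ hev₁ hev₂ c₁ c₂ hG0 =>
    GroundStateSimpleEven.exists_oddPrimitive_approximants hu₁ hu₂ hev₁ hev₂ c₁ c₂ hG0

end Summit.RiemannHypothesis.RiemannHypothesis.Theorems

end
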